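import Summits.QuantumFields.YangMills.Theorems.LangevinControlUVOSLegsFromFemtoAndGapStubAssemblyUniformBoundMain
import Summits.QuantumFields.YangMills.Theorems.LangevinControlUVOSLegsFromFemtoAndGapStubAssemblyCompactness
import Summits.QuantumFields.YangMills.Theorems.LangevinControlUVOSLegsFromFemtoAndGapStubAssemblyLimit
import Summits.QuantumFields.YangMills.Theorems.LangevinControlUVOSLegsFromFemtoAndGapStubAssemblyInheritance
import Summits.QuantumFields.YangMills.Theorems.LangevinControlUVOSLegsFromFemtoAndGapStubAssemblyNontrivial
import Summits.QuantumFields.YangMills.Theorems.OSLegsFromFemtoAndGap.Negative.UnitsAndGapFree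
import HarnessLib

/-!
# Soft OS-assembly toolkit XIII: the scheme in units `a` and the one-field SOFT legs

Helper file for stub `stub_assembly6` of crux `OSLegsFromFemtoAndGap` (stmt-QuantumFields-9367, line
`dlr-collar-transfer`).  **Milestone `softLegs_oneField`:** from `(∀ β, 0 < a β)`, `a → 0`, `MomentBounds`,
`LowerBounds` and `GapInUnits` ALONE one gets a scaling scheme `sch` in units `a` (`a_k = a(β_k)`, `β_k → ∞`,
`c ≡ a_k⁻⁴`, `m` = torus means, `L_k ≥ max(14, a_k⁻², S₁(β_k), Λ₅/a_k)`) and a one-field family `S₁` on `ℝ⁴` with: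
E0 (normalisation), E0′ (`HasLinearGrowth`), E3, invariance under ALL translations on `⁰𝒮`, the one-field
convergence clause of `PreOS` (every arity, every real tensor in `⁰𝒮`), the non-triviality and non-Gaussianity
clauses, `HasLatticeMassGap r sch c₁`, together with the bookkeeping the reflection-positivity blocks will need
(`S₁ 1 = 0`, `S₁ n` is the limit of the centred lattice distributions along `sch` for `n ≥ 2`, the uniform bound
`‖S₁ n F‖ ≤ 5Kⁿ‖F‖_{10n}`, `β_k → ∞`).  What is NOT here (and needs the plane-resolved data of reshape r2):
E0-hermiticity, E2, E4, the signed-permutation half of the hypercubic clause, `HasMassGap`.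
-/

noncomputable section

open scoped SchwartzMap BigOperators
open MeasureTheory Filter Topology
open Literature.MathematicalPhysics.QuantumFieldTheory Literature.MathematicalPhysics.QuantumLattice
open Literature.MathematicalPhysics.AQFT
open Literature.Probability.LatticeModels (box Site)
open Summit.QuantumFields.YangMills.Cruxes.OSLegsFromFemtoAndGap.DlrCollarTransfer
  (MomentBounds LowerBounds GapInUnits Q2 Q3)
open Summit.QuantumFields.YangMills.Theorems.OSLegsFromFemtoAndGap.Negative (hasLatticeMassGap_of_gapInUnits)

namespace Summit.QuantumFields.YangMills.Theorems.OSLegsFromFemtoAndGap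

local notation "E4" => EuclideanSpace ℝ (Fin 4)

variable {G : Type} [Group G] [TopologicalSpace G] [IsTopologicalGroup G] [CompactSpace G]
  [MeasurableSpace G] [BorelSpace G]

/-! ### Small facts -/

/-- `Kⁿ ≤ e^K · n!` for `K ≥ 0`. -/
theorem pow_le_exp_mul_factorial {K : ℝ} (hK : 0 ≤ K) (n : ℕ) : K ^ n ≤ Real.exp K * (n.factorial : ℝ) := by
  have h := Real.pow_div_factorial_le_exp (x := K) hK n
  rwa [div_le_iff₀ (by positivity)] at h

/-- `B + k → ∞`. -/
theorem tendsto_const_add_natCast (B : ℝ) : Tendsto (fun k : ℕ => B + (k : ℝ)) atTop atTop :=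
  tendsto_atTop_add_const_left _ _ tendsto_natCast_atTop_atTop

/-! ### The milestone -/

/-- **One-field soft legs from `MomentBounds`, `LowerBounds`, `GapInUnits`.**  See the module docstring. -/
theorem softLegs_oneField (r : LatticeRep G) {a : ℝ → ℝ} (hapos : ∀ β, 0 < a β)
    (hlim : Tendsto a atTop (𝓝 0)) (hMB : MomentBounds G r a) (hLB : LowerBounds G r a)
    (hgap : GapInUnits G r a) :
    ∃ (sch : SpeciesScheme (YMSpecies G)) (S₁ : SchwingerFamily E4),
      (∀ k, sch.a k = a (sch.β k)) ∧
      (∀ s k, sch.c s k = ((sch.a k)⁻¹) ^ 4) ∧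
      (∀ s k, sch.m s k = wilsonTorusMean r.ρ (sch.β k) (sch.L k) s.F) ∧
      Tendsto sch.β atTop atTop ∧
      S₁.toLabelled.IsNormalized ∧ S₁.toLabelled.HasLinearGrowth ∧ S₁.toLabelled.IsSymmetric ∧
      (∀ (n : ℕ) (t : E4) (F : 𝓢((Fin n → E4), ℂ)), IsOffDiagonal F → S₁ n (translateMulti t F) = S₁ n F) ∧
      (∀ F : 𝓢((Fin 1 → E4), ℂ), S₁ 1 F = 0) ∧
      (∀ n : ℕ, 2 ≤ n → ∀ F : 𝓢((Fin n → E4), ℂ), IsOffDiagonal F →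
        Tendsto (fun k => latticeDist r.ρ (sch.β k) (sch.L k) (sch.a k) r.curvature.F
          (wilsonTorusMean r.ρ (sch.β k) (sch.L k) r.curvature.F) n F) atTop (𝓝 (S₁ n F))) ∧
      (∃ K : ℝ, 0 ≤ K ∧ ∀ (n : ℕ) (F : 𝓢((Fin n → E4), ℂ)), ‖S₁ n F‖ ≤ 5 * K ^ n * schwartzNorm (10 * n) F) ∧
      (∀ n : ℕ, n ≠ 0 → ∀ (f : Fin n → 𝓢(E4, ℝ)) (F : 𝓢((Fin n → E4), ℂ)),
        IsTensorOf F (fun i => ofRealTest (f i)) → IsOffDiagonal F →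
          Tendsto (fun k : ℕ => ((latticeSchwinger r.ρ sch (fun s => s.F) k n (fun _ => r.curvature) f : ℝ) : ℂ))
            atTop (𝓝 (S₁ n F))) ∧
      (∃ (F₁ G₁ : 𝓢((Fin 1 → E4), ℂ)) (H₁ : 𝓢((Fin (1 + 1) → E4), ℂ)),
        IsTimeOrdered F₁ ∧ IsTimeOrdered G₁ ∧ IsAppendTensorOf H₁ (osAdjoint F₁) G₁ ∧
          S₁.toLabelled (1 + 1) (fun _ => ()) H₁ ≠
            S₁.toLabelled 1 (fun _ => ()) (osAdjoint F₁) * S₁.toLabelled 1 (fun _ => ()) G₁) ∧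
      (∃ (f g h : 𝓢(E4, ℂ)) (Ffgh : 𝓢((Fin 3 → E4), ℂ)) (Fgh Ffh Ffg : 𝓢((Fin 2 → E4), ℂ))
        (Ff Fg Fh : 𝓢((Fin 1 → E4), ℂ)),
        IsTensorOf Ffgh ![f, g, h] ∧ IsOffDiagonal Ffgh ∧ IsTensorOf Fgh ![g, h] ∧
        IsTensorOf Ffh ![f, h] ∧ IsTensorOf Ffg ![f, g] ∧ IsTensorOf Ff ![f] ∧ IsTensorOf Fg ![g] ∧
        IsTensorOf Fh ![h] ∧
          S₁.toLabelled 3 (fun _ => ()) Ffgh - S₁.toLabelled 1 (fun _ => ()) Ff * S₁.toLabelled 2 (fun _ => ()) Fgh -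
            S₁.toLabelled 1 (fun _ => ()) Fg * S₁.toLabelled 2 (fun _ => ()) Ffh -
            S₁.toLabelled 1 (fun _ => ()) Fh * S₁.toLabelled 2 (fun _ => ()) Ffg +
            2 * (S₁.toLabelled 1 (fun _ => ()) Ff * S₁.toLabelled 1 (fun _ => ()) Fg *
              S₁.toLabelled 1 (fun _ => ()) Fh) ≠ 0) ∧
      (∃ Δ : ℝ, 0 < Δ ∧ HasLatticeMassGap r sch Δ) := by
  classical
  /- 1. CONSTANTS: the a-uniform bound (VI-c), the gap data, the lower-bound data -/
  obtain ⟨β₄, ℓ₄, K, hℓ, hK, Hbd⟩ := latticeDist_norm_le_of_momentBounds r hMB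
  obtain ⟨c₁, β₂, S₁g, hc₁, Hgap⟩ := hgap
  obtain ⟨⟨v, ε₂, β₅, Λ₅, hv, hε₂, HQ2⟩, ⟨f₃, g₃, h₃, ε₃, β₆, Λ₆, hfg, hgh, hfh, hε₃, HQ3⟩⟩ := hLB
  -- `a β ≤ min 1 ℓ₄` for `β ≥ B₁`
  obtain ⟨B₁, hB₁⟩ : ∃ B₁ : ℝ, ∀ β, B₁ ≤ β → a β < min 1 ℓ₄ :=
    Filter.eventually_atTop.1 (hlim.eventually (gt_mem_nhds (by positivity)))
  /- 2. THE SEQUENCES: couplings above every threshold, spacings, tori -/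
  obtain ⟨B, hBdef⟩ : ∃ B : ℝ, B = max (max (max β₄ β₂) (max β₅ β₆)) B₁ := ⟨_, rfl⟩
  obtain ⟨βs, hβs⟩ : ∃ βs : ℕ → ℝ, βs = fun k : ℕ => B + (k : ℝ) := ⟨_, rfl⟩
  have hβsB : ∀ k, B ≤ βs k := fun k => by rw [hβs]; simp
  have hβs4 : ∀ k, β₄ ≤ βs k := fun k => le_trans (by rw [hBdef]; simp) (hβsB k)
  have hβs2 : ∀ k, β₂ ≤ βs k := fun k => le_trans (by rw [hBdef]; simp) (hβsB k)
  have hβs5 : ∀ k, β₅ ≤ βs k := fun k => le_trans (by rw [hBdef]; simp) (hβsB k)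
  have hβs6 : ∀ k, β₆ ≤ βs k := fun k => le_trans (by rw [hBdef]; simp) (hβsB k)
  have hβs1 : ∀ k, B₁ ≤ βs k := fun k => le_trans (by rw [hBdef]; simp) (hβsB k)
  have hβs_top : Tendsto βs atTop atTop := by rw [hβs]; exact tendsto_const_add_natCast B
  have ha_pos : ∀ k, 0 < a (βs k) := fun k => hapos _
  have ha_1 : ∀ k, a (βs k) ≤ 1 := fun k => (hB₁ _ (hβs1 k)).le.trans (min_le_left _ _)
  have ha_ℓ : ∀ k, a (βs k) ≤ ℓ₄ := fun k => (hB₁ _ (hβs1 k)).le.trans (min_le_right _ _)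
  have ha_top : Tendsto (fun k => a (βs k)) atTop (𝓝 0) := hlim.comp hβs_top
  obtain ⟨Ls, hLs⟩ : ∃ Ls : ℕ → ℕ, Ls = fun k =>
      max (max 14 (S₁g (βs k))) (max ⌈(a (βs k))⁻¹ * (a (βs k))⁻¹⌉₊ ⌈max Λ₅ Λ₆ / a (βs k)⌉₊) := ⟨_, rfl⟩
  have hL14 : ∀ k, 14 ≤ Ls k := fun k => by rw [hLs]; exact le_trans (le_max_left _ _) (le_max_left _ _)
  have hLS : ∀ k, S₁g (βs k) ≤ Ls k := fun k => by
    rw [hLs]; exact le_trans (le_max_right _ _) (le_max_left _ _)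
  have hLa : ∀ k, (a (βs k))⁻¹ * (a (βs k))⁻¹ ≤ Ls k := fun k => by
    have h1 : ((⌈(a (βs k))⁻¹ * (a (βs k))⁻¹⌉₊ : ℕ) : ℝ) ≤ Ls k := by
      rw [hLs]; exact_mod_cast le_trans (le_max_left _ _) (le_max_right _ _)
    exact (Nat.le_ceil _).trans h1
  have hLΛ : ∀ k, max Λ₅ Λ₆ ≤ a (βs k) * Ls k := fun k => by
    have h1 : ((⌈max Λ₅ Λ₆ / a (βs k)⌉₊ : ℕ) : ℝ) ≤ Ls k := by
      rw [hLs]; exact_mod_cast le_trans (le_max_right _ _) (le_max_right _ _)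
    have h2 : max Λ₅ Λ₆ / a (βs k) ≤ Ls k := (Nat.le_ceil _).trans h1
    rw [div_le_iff₀ (ha_pos k)] at h2
    linarith [mul_comm (Ls k : ℝ) (a (βs k))]
  have haL_top : Tendsto (fun k => a (βs k) * Ls k) atTop atTop := by
    -- `a L ≥ a · a⁻² = a⁻¹ → ∞`
    have h1 : Tendsto (fun k => (a (βs k))⁻¹) atTop atTop :=
      tendsto_inv_nhdsGT_zero.comp (tendsto_nhdsWithin_iff.2 ⟨ha_top, Eventually.of_forall fun k => ha_pos k⟩)
    refine tendsto_atTop_mono (fun k => ?_) h1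
    have := mul_le_mul_of_nonneg_left (hLa k) (ha_pos k).le
    rwa [← mul_assoc, mul_inv_cancel₀ (ha_pos k).ne', one_mul] at this
  /- 3. THE SUBSEQUENCE AND THE LIMIT on `⁰𝒮ₙ`, `n ≥ 2` (toolkit II fed with VI-c) -/
  obtain ⟨T, hT⟩ : ∃ T : (n : ℕ) → ℕ → (𝓢((Fin n → E4), ℂ) →L[ℂ] ℂ),
      T = fun n k => if 2 ≤ n then latticeDist r.ρ (βs k) (Ls k) (a (βs k)) r.curvature.F
        (wilsonTorusMean r.ρ (βs k) (Ls k) r.curvature.F) n else 0 := ⟨_, rfl⟩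
  let Mod : (n : ℕ) → Submodule ℂ 𝓢((Fin n → E4), ℂ) := fun n =>
    { carrier := {F | IsOffDiagonal F}
      add_mem' := fun hF hG => hF.add hG
      zero_mem' := isOffDiagonal_zero
      smul_mem' := fun c _ hF => hF.smul c }
  have hMod : ∀ n (F : 𝓢((Fin n → E4), ℂ)), F ∈ Mod n ↔ IsOffDiagonal F := fun n F => Iff.rfl
  have hlat : ∀ (n k : ℕ), 2 ≤ n → ∀ F : 𝓢((Fin n → E4), ℂ), IsOffDiagonal F →
      ‖latticeDist r.ρ (βs k) (Ls k) (a (βs k)) r.curvature.F (wilsonTorusMean r.ρ (βs k) (Ls k) r.curvature.F) n F‖ ≤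
        5 * K ^ n * schwartzNorm (10 * n) F := by
    intro n k hn F hF
    calc _ ≤ K ^ n * (SchwartzMap.seminorm ℂ 0 (4 * n) F + SchwartzMap.seminorm ℂ (6 * n) (4 * n) F +
          SchwartzMap.seminorm ℂ 0 0 F + SchwartzMap.seminorm ℂ (6 * n) 0 F +
          SchwartzMap.seminorm ℂ (10 * n) 0 F) :=
          Hbd (βs k) (hβs4 k) (ha_pos k) (ha_1 k) (ha_ℓ k) (Ls k) (hL14 k) (hLa k) n hn F hF
      _ ≤ K ^ n * (5 * schwartzNorm (10 * n) F) := by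
          gcongr; exact seminorm_budget_le_schwartzNorm n F
      _ = _ := by ring
  have hbound : ∀ n k, ∀ F ∈ Mod n, ‖T n k F‖ ≤ 5 * K ^ n * schwartzNorm (10 * n) F := by
    intro n k F hF
    rw [hMod] at hF
    by_cases hn : 2 ≤ n
    · rw [hT]; dsimp only; rw [if_pos hn]; exact hlat n k hn F hF
    · rw [hT]; dsimp only; rw [if_neg hn]; simp only [zero_apply, norm_zero]
      exact mul_nonneg (by positivity) (schwartzNorm_nonneg _ _)
  obtain ⟨φ, hφ, S, hS, hconvS⟩ := exists_subseq_clm_limit (X := fun n : ℕ => Fin n → E4) T Mod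
    (fun n => 10 * n) (fun n => 5 * K ^ n) (fun n => by positivity) hbound
  have hconv2 : ∀ n, 2 ≤ n → ∀ F : 𝓢((Fin n → E4), ℂ), IsOffDiagonal F →
      Tendsto (fun j => latticeDist r.ρ (βs (φ j)) (Ls (φ j)) (a (βs (φ j))) r.curvature.F
        (wilsonTorusMean r.ρ (βs (φ j)) (Ls (φ j)) r.curvature.F) n F) atTop (𝓝 (S n F)) := by
    intro n hn F hF
    have h := hconvS n F ((hMod n F).2 hF)
    rw [hT] at h; dsimp only at h; simp only [if_pos hn] at h; exact h
  /- 4. THE ONE-FIELD FAMILY: evaluation / zero / the limit -/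
  obtain ⟨S₁, hS₁⟩ : ∃ S₁ : SchwingerFamily E4, S₁ = fun n =>
      if n = 0 then LabelledSchwingerFamily.evalAt (default : Fin n → E4) else if n = 1 then 0 else S n :=
    ⟨_, rfl⟩
  have hS₁0 : ∀ F : 𝓢((Fin 0 → E4), ℂ), S₁ 0 F = F default := fun F => by rw [hS₁]; simp
  have hS₁1 : ∀ F : 𝓢((Fin 1 → E4), ℂ), S₁ 1 F = 0 := fun F => by rw [hS₁]; simp
  have hS₁2 : ∀ n, 2 ≤ n → S₁ n = S n := fun n hn => by
    rw [hS₁]; dsimp only; rw [if_neg (by omega), if_neg (by omega)]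
  /- 5. THE SCHEME along the subsequence -/
  let sch : SpeciesScheme (YMSpecies G) :=
    { a := fun j => a (βs (φ j))
      a_pos := fun j => ha_pos _
      tendsto_a := ha_top.comp hφ.tendsto_atTop
      β := fun j => βs (φ j)
      L := fun j => Ls (φ j)
      tendsto_L := haL_top.comp hφ.tendsto_atTop
      c := fun _ j => ((a (βs (φ j)))⁻¹) ^ 4
      m := fun s j => wilsonTorusMean r.ρ (βs (φ j)) (Ls (φ j)) s.F }
  /- 6. CONVERGENCE of every arity along `sch` -/
  have hconv_all : ∀ (n : ℕ) (F : 𝓢((Fin n → E4), ℂ)), IsOffDiagonal F →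
      Tendsto (fun j => latticeDist r.ρ (βs (φ j)) (Ls (φ j)) (a (βs (φ j))) r.curvature.F
        (wilsonTorusMean r.ρ (βs (φ j)) (Ls (φ j)) r.curvature.F) n F) atTop (𝓝 (S₁ n F)) := by
    intro n F hF
    rcases Nat.lt_or_ge n 2 with hn | hn
    · interval_cases n
      · simp_rw [latticeDist_zero_apply r.ρ r.continuous, hS₁0]; exact tendsto_const_nhds
      · simp_rw [latticeDist_one_apply, hS₁1]; exact tendsto_const_nhds
    · rw [hS₁2 n hn]; exact hconv2 n hn F hF
  /- 7. E0, E3, E1-translations by inheritance (toolkit VIII-b) -/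
  obtain ⟨C₀, hC₀⟩ := r.curvature.bounded
  have hC₀0 : 0 ≤ C₀ := le_trans (abs_nonneg _) (hC₀ (fun _ => 1))
  have hW : ∀ (n j : ℕ) (x : Fin n → Site 4), |torusMoment r.ρ (βs (φ j)) (Ls (φ j)) r.curvature.F
      (wilsonTorusMean r.ρ (βs (φ j)) (Ls (φ j)) r.curvature.F) x| ≤ (C₀ + C₀) ^ n := by
    intro n j x
    refine (abs_torusMoment_le_pow r _ _ r.curvature hC₀ _ x).trans ?_
    exact pow_le_pow_left₀ (by positivity)
      (by linarith [abs_wilsonTorusMean_le r (βs (φ j)) (Ls (φ j)) r.curvature hC₀]) n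
  have hlatAll : ∀ n, ∀ᶠ j in atTop, ∀ F : 𝓢((Fin n → E4), ℂ), IsOffDiagonal F →
      ‖latticeDist r.ρ (βs (φ j)) (Ls (φ j)) (a (βs (φ j))) r.curvature.F
        (wilsonTorusMean r.ρ (βs (φ j)) (Ls (φ j)) r.curvature.F) n F‖ ≤ 5 * K ^ n * schwartzNorm (10 * n) F := by
    intro n
    refine Eventually.of_forall fun j F hF => ?_
    rcases Nat.lt_or_ge n 2 with hn | hn
    · interval_cases n
      · rw [latticeDist_zero_apply r.ρ r.continuous]
        have h1 := norm_le_schwartzNorm 0 F default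
        have h0 := schwartzNorm_nonneg 0 F
        simp only [pow_zero, mul_one, mul_zero]
        linarith
      · rw [latticeDist_one_apply, norm_zero]; exact mul_nonneg (by positivity) (schwartzNorm_nonneg _ _)
    · exact hlat n (φ j) hn F hF
  obtain ⟨hE0, hE3, htrans⟩ := limit_isNormalized_isSymmetric_translate r.ρ r.continuous
    (fun j => βs (φ j)) (fun j => Ls (φ j)) (fun j => a (βs (φ j))) r.curvature.F
    (fun j => wilsonTorusMean r.ρ (βs (φ j)) (Ls (φ j)) r.curvature.F) S₁ hconv_all
    (fun n => 5 * K ^ n) (fun n => 10 * n) hlatAll (by positivity : (0 : ℝ) ≤ C₀ + C₀) hW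
    (fun j => ha_pos _) (fun j => ha_1 _) (fun j => hLa _) (ha_top.comp hφ.tendsto_atTop)
  /- 8. E0′ -/
  have hbdS₁ : ∀ (n : ℕ) (F : 𝓢((Fin n → E4), ℂ)), ‖S₁ n F‖ ≤ 5 * K ^ n * schwartzNorm (10 * n) F := by
    intro n F
    rcases Nat.lt_or_ge n 2 with hn | hn
    · interval_cases n
      · rw [hS₁0]
        have h1 := norm_le_schwartzNorm 0 F default
        have h0 := schwartzNorm_nonneg 0 F
        simp only [pow_zero, mul_one, mul_zero]
        linarith
      · rw [hS₁1, norm_zero]; exact mul_nonneg (by positivity) (schwartzNorm_nonneg _ _)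
    · rw [hS₁2 n hn]; exact hS n F
  have hE0' : S₁.toLabelled.HasLinearGrowth := by
    intro _
    refine ⟨10, 5 * Real.exp K, 1, fun n k _ F _ => ?_⟩
    simp only [SchwingerFamily.toLabelled_apply, Real.rpow_one]
    calc ‖S₁ n F‖ ≤ 5 * K ^ n * schwartzNorm (10 * n) F := hbdS₁ n F
      _ ≤ 5 * (Real.exp K * (n.factorial : ℝ)) * schwartzNorm (10 * n) F := by
          gcongr
          · exact schwartzNorm_nonneg _ _
          · exact pow_le_exp_mul_factorial hK n
      _ = 5 * Real.exp K * (n.factorial : ℝ) * schwartzNorm (n * 10) F := by rw [mul_comm n 10]; ring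
  /- 9. THE ONE-FIELD CONVERGENCE CLAUSE along `sch` (`c a⁴ = 1`) -/
  have hYM : ∀ n : ℕ, n ≠ 0 → ∀ (f : Fin n → 𝓢(E4, ℝ)) (F : 𝓢((Fin n → E4), ℂ)),
      IsTensorOf F (fun i => ofRealTest (f i)) → IsOffDiagonal F →
        Tendsto (fun k : ℕ => ((latticeSchwinger r.ρ sch (fun s => s.F) k n (fun _ => r.curvature) f : ℝ) : ℂ))
          atTop (𝓝 (S₁ n F)) := by
    intro n _ f F hF hod
    have hkey : ∀ k, ((latticeSchwinger r.ρ sch (fun s => s.F) k n (fun _ => r.curvature) f : ℝ) : ℂ) =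
        latticeDist r.ρ (βs (φ k)) (Ls (φ k)) (a (βs (φ k))) r.curvature.F
          (wilsonTorusMean r.ρ (βs (φ k)) (Ls (φ k)) r.curvature.F) n F := by
      intro k
      rw [latticeSchwinger_eq_latticeDist r sch r.curvature k n f F hF]
      have hc : sch.c r.curvature k * (sch.a k) ^ 4 = 1 := by
        show ((a (βs (φ k)))⁻¹) ^ 4 * (a (βs (φ k))) ^ 4 = 1
        rw [← mul_pow, inv_mul_cancel₀ (ha_pos _).ne', one_pow]
      rw [hc, one_pow, Complex.ofReal_one, one_mul]
    simp_rw [hkey]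
    exact hconv_all n F hod
  /- 10. NON-TRIVIALITY, NON-GAUSSIANITY (toolkit XI-b) -/
  have hβφ : Tendsto (fun j => βs (φ j)) atTop atTop := hβs_top.comp hφ.tendsto_atTop
  have haLφ : Tendsto (fun j => a (βs (φ j)) * Ls (φ j)) atTop atTop := haL_top.comp hφ.tendsto_atTop
  have hNT := twoPointNontrivial_of_lowerBounds r ⟨v, ε₂, β₅, Λ₅, hv, hε₂, HQ2⟩ (fun j => βs (φ j))
    (fun j => Ls (φ j)) hβφ haLφ S₁ hS₁1 (hconv_all 2)
  have hNG := nonGaussian_of_lowerBounds r ⟨f₃, g₃, h₃, ε₃, β₆, Λ₆, hfg, hgh, hfh, hε₃, HQ3⟩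
    (fun j => βs (φ j)) (fun j => Ls (φ j)) hβφ haLφ S₁ hS₁1 (hconv_all 3)
  /- 11. THE LATTICE GAP in units `a` along `sch` -/
  have hLG : HasLatticeMassGap r sch c₁ :=
    hasLatticeMassGap_of_gapInUnits r Hgap sch (fun k => rfl) (Eventually.of_forall fun k => hβs2 _)
      (Eventually.of_forall fun k => hLS _)
  /- 12. ASSEMBLE -/
  refine ⟨sch, S₁, fun k => rfl, fun s k => rfl, fun s k => rfl, hβφ, hE0, hE0', hE3, htrans, hS₁1,
    fun n _ F hF => hconv_all n F hF, ⟨K, hK, hbdS₁⟩, hYM, hNT, hNG, c₁, hc₁, hLG⟩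

end Summit.QuantumFields.YangMills.Theorems.OSLegsFromFemtoAndGap

end
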